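import Literature.AlgebraicGeometry.Motives.HodgeThetaSubalgebraUnitaryCoprimeStep
import HarnessLib

/-!
# The raising-rank lemma, Ψ-route: a raising operator of rank `r = dim P − 1` can be improved when
# `dim Q − r > r(r−1)/2` (Ribet 1983 Thm. 3, Lie step; the counting argument of the rank-three lemma, in general rank)

Family `hodge`, layer `Literature/AlgebraicGeometry/Motives` (pure linear algebra over `ℂ`; no geometry). Research
context: cell `pub-hodge-ring2` (HONEST FRAMING: research route conditional on HC_CM; not a corollary; Q11.4-sentence-2
already refuted in dim ≥ 3), Literature lane gen 83, programme R65. UNCONDITIONAL; theorems only, no definition, no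
named fact (D-0026), no `sorry`. Companion of `HodgeThetaSubalgebraUnitaryRaisingRank` (the Φ-route, Levi instance on
`P₁ ⊕ Q₀`): here the Levi instance is taken on `P₀ ⊕ Q₁` (type `(1 | r)`, whose core — the pure `(m,1)` core
`UnitaryThreeCoprime.eq_top_of_finrank_eq_one` — is a theorem for every `r ≥ 2`), so NO core hypothesis is needed; the
price is the counting condition `dim Q − r > r(r−1)/2`. This is §4 of `HodgeThetaSubalgebraUnitaryThreeCoprimeCore`
(`exists_raise_onto_three`, `r = 2`) in general rank `r`, with its STEP 7 replaced by the relation (♣) alone.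

THE THEOREMS. (A) `UnitaryRaisingRank.exists_raise_rank_gt_of_finrank_eq_succ`. Setting of the unitary cores; `B ∈ 𝔊`
raising of rank `r ≥ 2` with `dim P = r + 1` and `dim Q > r + C(r, 2)`. Then some raising operator
has rank `> r` (i.e. maps onto `P`). PROOF: if not, with `C = B†`, the projector pair `D`, (★) and (♣) as in the
Φ-route, `P₀ = P ∩ ker C = ℂη`, and the Levi instance on `{2D − Θ = −1} = P₀ ⊕ Q₁` solved by the `(m,1)` core, there
are raising `B_j ∈ 𝔊` (`j < r`) with `B_j(C e_i) = δ_ij η` for a basis `e` of `P₁ = B(W)`; (♣) gives the SKEW relations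
`e_i^*(B_j q) + e_j^*(B_i q) = 0` (`q ∈ Q₀`) and, for every raising `B'` and `q ∈ Q₀` with all `B_j q = 0`:
`e_j^*(B' q) η = B_j(C B'q) ∈ P₁`, so `B' q = 0`. The linear map `q ↦ (e_i^*(B_j q))_{i<j}` on `Q₀` (dimension
`dim Q − r`) has a non-zero kernel vector by counting; it is killed by every `B_j`, hence by every raising operator —
contradicting the covering lemma.
(B) `UnitaryRaisingRank.exists_raise_rank_gt_of_psi_core` (appended, same session): `dim P ≥ r + 2` and the abstract
core of type `(dim P − r | r)` instead of counting — two independent `η₀, η₁ ∈ P₀` and (♣) alone.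

## References
* [Ribet1983] K. A. Ribet, Amer. J. Math. 105 (1983), Thm. 3 (= [Gordon1997, Thm. 6.3 (3)], pp. 18–19).
* [Deligne1982HodgeCycles] P. Deligne, LNM 900 (1982), I §3 Prop. 3.4, 3.6.
* [GoodmanWallachGTM255] R. Goodman, N. R. Wallach, GTM 255 (2009), §4.1.1.
* [HoffmanKunze1971LinearAlgebra] K. Hoffman, R. Kunze, *Linear Algebra* (1971), §3.2 (rank–nullity), §6.8.
-/

noncomputable section

namespace Literature.AlgebraicGeometry.Motives

namespace HodgeStructure

universe u

variable {W : Type u} [AddCommGroup W] [Module ℂ W]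

/-- `#{(i, j) : i < j < n} = C(n, 2)` (pairs `i < j` in `Fin n` correspond to `Σ j, Fin j`). [folklore] -/
private theorem UnitaryRaisingRank.card_pairs_lt (n : ℕ) : Fintype.card {p : Fin n × Fin n // p.1 < p.2} = n.choose 2 := by
  classical
  let e : {p : Fin n × Fin n // p.1 < p.2} ≃ (Σ j : Fin n, Fin j) :=
    { toFun := fun p => ⟨p.1.2, ⟨p.1.1, p.2⟩⟩
      invFun := fun x => ⟨(⟨x.2, lt_trans x.2.2 x.1.2⟩, x.1), x.2.2⟩
      left_inv := fun p => by rcases p with ⟨⟨a, b⟩, h⟩; rfl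
      right_inv := fun x => by rcases x with ⟨j, i⟩; rfl }
  rw [Fintype.card_congr e, Fintype.card_sigma]
  simp only [Fintype.card_fin]
  rw [Fin.sum_univ_eq_sum_range (fun i => i) n, Finset.sum_range_id, Nat.choose_two_right]

/-- `x² = 1 ⟹ (−x)² = 1` in a ring (used for the involution `−ι` of a Levi instance). [folklore] -/
private theorem UnitaryRaisingRank.neg_mul_neg_eq_one_of {R : Type*} [Ring R] {x : R} (h : x * x = 1) : (-x) * (-x) = 1 := by
  rw [neg_mul_neg, h]

/-- **The raising-rank lemma, Ψ-route (`dim P = r + 1`, counting).** See the module docstring.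
[cite: Ribet1983, Thm. 3] [cite: Deligne1982HodgeCycles, I §3 Prop. 3.6] [cite: GoodmanWallachGTM255, §4.1.1] -/
theorem UnitaryRaisingRank.exists_raise_rank_gt_of_finrank_eq_succ [FiniteDimensional ℂ W] {𝔊 : Submodule ℂ (Module.End ℂ W)}
    (hbr : ∀ Y ∈ 𝔊, ∀ Z ∈ 𝔊, Y * Z - Z * Y ∈ 𝔊)
    (hirr : ∀ U : Submodule ℂ W, (∀ A ∈ 𝔊, ∀ u ∈ U, A u ∈ U) → U = ⊥ ∨ U = ⊤)
    {Θ : Module.End ℂ W} (hΘ : Θ ∈ 𝔊) (hΘΘ : Θ * Θ = 1)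
    {P Q : Submodule ℂ W} (hP : ∀ x, x ∈ P ↔ Θ x = x) (hQ : ∀ x, x ∈ Q ↔ Θ x = -x)
    {B : Module.End ℂ W} (hB : B ∈ 𝔊) (hΘB : Θ * B = B) (hBΘ : B * Θ = -B)
    (hr2 : 2 ≤ Module.finrank ℂ (LinearMap.range B))
    (hrP : Module.finrank ℂ P = Module.finrank ℂ (LinearMap.range B) + 1)
    (hrQ : (Module.finrank ℂ (LinearMap.range B)).choose 2 + Module.finrank ℂ (LinearMap.range B) < Module.finrank ℂ Q)
    {s : W → W → ℂ} (hadd : ∀ x y z, s (x + y) z = s x z + s y z) (hsymm : ∀ x y, s y x = starRingEnd ℂ (s x y))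
    (hPQ : ∀ p ∈ P, ∀ q ∈ Q, s p q = 0) (hdefP : ∀ p ∈ P, s p p = 0 → p = 0) (hdefQ : ∀ q ∈ Q, s q q = 0 → q = 0)
    (hadj : ∀ X ∈ 𝔊, ∃ Y ∈ 𝔊, ∀ x y, s (X x) y = s x (Y y)) :
    ∃ B' ∈ 𝔊, Θ * B' = B' ∧ B' * Θ = -B' ∧
      Module.finrank ℂ (LinearMap.range B) < Module.finrank ℂ (LinearMap.range B') := by
  classical
  obtain ⟨haddr, h0r, h0l, hnegr, hnegl, hsubr, hsubl⟩ := UnitaryTwoOdd.herm_right hadd hsymm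
  have hΘΘv : ∀ v, Θ (Θ v) = v := fun v => by rw [← Module.End.mul_apply, hΘΘ, Module.End.one_apply]
  have hPhat : ∀ w, (2 : ℂ)⁻¹ • (w + Θ w) ∈ P := fun w => (hP _).2 (by rw [map_smul, map_add, hΘΘv, add_comm])
  have hQhat : ∀ w, (2 : ℂ)⁻¹ • (w - Θ w) ∈ Q := fun w =>
    (hQ _).2 (by rw [map_smul, map_sub, hΘΘv, ← smul_neg, neg_sub])
  have hsplit : ∀ w, (2 : ℂ)⁻¹ • (w + Θ w) + (2 : ℂ)⁻¹ • (w - Θ w) = w := fun w => by module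
  have hP0 : ∃ p : W, p ≠ 0 ∧ Θ p = p := by
    obtain ⟨⟨p, hp⟩, hp0⟩ := Module.finrank_pos_iff_exists_ne_zero.1 (show 0 < Module.finrank ℂ P by omega)
    exact ⟨p, fun h => hp0 (Subtype.ext h), (hP p).1 hp⟩
  have hraiseval : ∀ Z : Module.End ℂ W, Θ * Z = Z → ∀ w, Z w ∈ P := fun Z hΘZ w =>
    (hP _).2 (by rw [← Module.End.mul_apply, hΘZ])
  have hraiseP : ∀ Z : Module.End ℂ W, Z * Θ = -Z → ∀ p ∈ P, Z p = 0 := fun Z hZΘ p hp => by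
    have h : Z p = -(Z p) := by
      conv_lhs => rw [← (hP p).1 hp]
      rw [← Module.End.mul_apply, hZΘ, LinearMap.neg_apply]
    have h2 : (2 : ℂ) • Z p = 0 := by rw [two_smul]; nth_rewrite 2 [h]; rw [add_neg_cancel]
    exact (smul_eq_zero.1 h2).resolve_left two_ne_zero
  have hΘs := UnitaryTwoOdd.theta_selfAdjoint hadd hsymm hΘΘ hP hQ hPQ
  by_contra hcon
  push Not at hcon
  have hmax : ∀ B' ∈ 𝔊, Θ * B' = B' → B' * Θ = -B' →
      Module.finrank ℂ (LinearMap.range B') ≤ Module.finrank ℂ (LinearMap.range B) := hcon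
  -- STEP 1: `B`, its adjoint `C` and the projector pair `D`
  have hBmem : ∀ w, B w ∈ P := hraiseval B hΘB
  have hBP : ∀ p ∈ P, B p = 0 := hraiseP B hBΘ
  have hrangeP : LinearMap.range B ≤ P := by rintro _ ⟨w, rfl⟩; exact hBmem w
  obtain ⟨C, hC, hBC⟩ := hadj B hB
  obtain ⟨hΘC, hCΘ⟩ := UnitaryTwoOdd.lower_of_adjoint hadd hsymm hΘΘ hP hQ hPQ hdefP hdefQ hΘB hBΘ hBC
  have hCmem : ∀ w, C w ∈ Q := fun w => (hQ _).2 (by rw [← Module.End.mul_apply, hΘC, LinearMap.neg_apply])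
  have hCQ : ∀ q ∈ Q, C q = 0 := fun q hq => by
    have h : C q = -(C q) := by
      conv_lhs => rw [← neg_neg q, ← (hQ q).1 hq, map_neg, ← Module.End.mul_apply, hCΘ]
    have h2 : (2 : ℂ) • C q = 0 := by rw [two_smul]; nth_rewrite 2 [h]; rw [add_neg_cancel]
    exact (smul_eq_zero.1 h2).resolve_left two_ne_zero
  obtain ⟨D, hD, hDΘ, hD1, hD2, hD3, hD4, hD5, hD6, hpos1, hpos2, hdec, hDs⟩ :=
    UnitaryThreeCoprime.exists_projector_pair hbr hΘΘ hP hQ hadd hsymm hPQ hdefP hdefQ hB hC hΘB hBΘ hBC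
  have hDP : ∀ p ∈ P, D p ∈ P := fun p hp => hrangeP (hD5 p hp).1
  have hDfix : ∀ x ∈ LinearMap.range B, D x = x := by rintro _ ⟨w, rfl⟩; exact hD1 w
  have hDDP : ∀ p ∈ P, D (D p) = D p := fun p hp => hDfix _ (hD5 p hp).1
  have hkerD : ∀ p ∈ P, D p = 0 → C p = 0 := fun p hp h => by
    have h' := (hD5 p hp).2; rwa [h, sub_zero] at h'
  have hCinjR : ∀ x ∈ LinearMap.range B, C x = 0 → x = 0 := by rintro _ ⟨w, rfl⟩ h; exact hpos2 w h
  have hCD : ∀ p ∈ P, C p = C (D p) := fun p hp => by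
    have h := (hD5 p hp).2; rw [map_sub, sub_eq_zero] at h; exact h
  -- STEP 2 (★): every raising operator maps `Q₀ = Q ∩ ker B` into `P₁ = B(W)`
  have hcommbr : ∀ X : Module.End ℂ W, Θ * X = X → X * Θ = -X →
      Θ * (D * X - X * D) = D * X - X * D ∧ (D * X - X * D) * Θ = -(D * X - X * D) := fun X h1 h2 =>
    ⟨by rw [mul_sub, ← mul_assoc, ← hDΘ, mul_assoc, h1, ← mul_assoc, h1],
     by rw [sub_mul, mul_assoc, h2, mul_assoc, hDΘ, ← mul_assoc, h2, mul_neg, neg_mul, neg_sub_neg, neg_sub]⟩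
  have hstar : ∀ B' ∈ 𝔊, Θ * B' = B' → B' * Θ = -B' → ∀ q ∈ Q, B q = 0 → D (B' q) = B' q := by
    intro B' hB' hΘB' hB'Θ
    by_contra hne
    push Not at hne
    obtain ⟨q₀, hq₀Q, hBq₀, hneq⟩ := hne
    have hB'P : ∀ p ∈ P, B' p = 0 := hraiseP B' hB'Θ
    have hB'mem : ∀ w, B' w ∈ P := hraiseval B' hΘB'
    set N : Module.End ℂ W := D * B' - B' * D with hNdef
    obtain ⟨hΘN, hNΘ⟩ : Θ * N = N ∧ N * Θ = -N := hcommbr B' hΘB' hB'Θ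
    set N₂ : Module.End ℂ W := D * N - N * D with hN₂def
    obtain ⟨hΘN₂, hN₂Θ⟩ : Θ * N₂ = N₂ ∧ N₂ * Θ = -N₂ := hcommbr N hΘN hNΘ
    have hNmem : N ∈ 𝔊 := hbr D hD B' hB'
    have hN₂mem : N₂ ∈ 𝔊 := hbr D hD N hNmem
    set B₀ : Module.End ℂ W := (2 : ℂ)⁻¹ • (N₂ - (3 : ℂ) • N + (2 : ℂ) • B') with hB₀def
    have hB₀mem : B₀ ∈ 𝔊 := Submodule.smul_mem _ _ (Submodule.add_mem _ (Submodule.sub_mem _ hN₂mem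
      (Submodule.smul_mem _ _ hNmem)) (Submodule.smul_mem _ _ hB'))
    have hΘB₀ : Θ * B₀ = B₀ := by
      rw [hB₀def, mul_smul_comm, mul_add, mul_sub, mul_smul_comm, mul_smul_comm, hΘN₂, hΘN, hΘB']
    have hB₀Θ : B₀ * Θ = -B₀ := by
      rw [hB₀def, smul_mul_assoc, add_mul, sub_mul, smul_mul_assoc, smul_mul_assoc, hN₂Θ, hNΘ, hB'Θ]
      module
    -- values of `N`, `N₂`, `B₀`
    have hNq : ∀ q ∈ Q, B q = 0 → N q = D (B' q) := fun q hq hBq => by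
      rw [hNdef, LinearMap.sub_apply, Module.End.mul_apply, Module.End.mul_apply, hD4 q hq hBq, map_zero, sub_zero]
    have hNP : ∀ p ∈ P, N p = 0 := fun p hp => by
      rw [hNdef, LinearMap.sub_apply, Module.End.mul_apply, Module.End.mul_apply, hB'P p hp, map_zero,
        hB'P _ (hDP p hp), sub_zero]
    have hNC : ∀ p ∈ P, N (C p) = D (B' (C p)) + B' (C p) := fun p hp => by
      rw [hNdef, LinearMap.sub_apply, Module.End.mul_apply, Module.End.mul_apply, hD3 p hp, map_neg, sub_neg_eq_add]
    have hN₂q : ∀ q ∈ Q, B q = 0 → N₂ q = D (B' q) := fun q hq hBq => by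
      rw [hN₂def, LinearMap.sub_apply, Module.End.mul_apply, Module.End.mul_apply, hNq q hq hBq, hD4 q hq hBq,
        map_zero, sub_zero, hDDP _ (hB'mem q)]
    have hN₂C : ∀ p ∈ P, N₂ (C p) = D (B' (C p)) + D (B' (C p)) + (D (B' (C p)) + B' (C p)) := fun p hp => by
      rw [hN₂def, LinearMap.sub_apply, Module.End.mul_apply, Module.End.mul_apply, hNC p hp, hD3 p hp, map_neg,
        hNC p hp, map_add, hDDP _ (hB'mem _), sub_neg_eq_add]
    have hB₀q : ∀ q ∈ Q, B q = 0 → B₀ q = B' q - D (B' q) := fun q hq hBq => by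
      rw [hB₀def, LinearMap.smul_apply, LinearMap.add_apply, LinearMap.sub_apply, LinearMap.smul_apply,
        LinearMap.smul_apply, hN₂q q hq hBq, hNq q hq hBq]
      module
    have hB₀C : ∀ p ∈ P, B₀ (C p) = 0 := fun p hp => by
      rw [hB₀def, LinearMap.smul_apply, LinearMap.add_apply, LinearMap.sub_apply, LinearMap.smul_apply,
        LinearMap.smul_apply, hN₂C p hp, hNC p hp]
      module
    -- `B + B₀` is raising and maps onto `P`
    have hsum_mem : B + B₀ ∈ 𝔊 := Submodule.add_mem _ hB hB₀mem
    have hΘsum : Θ * (B + B₀) = B + B₀ := by rw [mul_add, hΘB, hΘB₀]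
    have hsumΘ : (B + B₀) * Θ = -(B + B₀) := by rw [add_mul, hBΘ, hB₀Θ, neg_add]
    set x₀ := B' q₀ - D (B' q₀) with hx₀def
    have hx₀P : x₀ ∈ P := Submodule.sub_mem _ (hB'mem q₀) (hDP _ (hB'mem q₀))
    have hx₀0 : x₀ ≠ 0 := fun h => hneq (by rw [hx₀def, sub_eq_zero] at h; exact h.symm)
    have hx₀nr : x₀ ∉ LinearMap.range B := fun h => by
      have h1 := hDfix x₀ h
      rw [hx₀def, map_sub, hDDP _ (hB'mem q₀), sub_self] at h1
      exact hx₀0 h1.symm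
    have hx₀val : (B + B₀) q₀ = x₀ := by
      rw [LinearMap.add_apply, hBq₀, zero_add, hB₀q q₀ hq₀Q hBq₀]
    have hrange1 : LinearMap.range B ≤ LinearMap.range (B + B₀) := by
      rintro _ ⟨w, rfl⟩
      set q := (2 : ℂ)⁻¹ • (w - Θ w) with hqdef
      obtain ⟨hDq, hBq⟩ := hD6 q (hQhat w)
      obtain ⟨p', hp', hp'q⟩ := hDq
      refine ⟨-(D q), ?_⟩
      have hBw : B w = B q := by
        conv_lhs => rw [← hsplit w, map_add, hBP _ (hPhat w), zero_add]
      rw [LinearMap.add_apply, map_neg, map_neg, ← hp'q, hB₀C p' hp', neg_zero, add_zero, hp'q, hBw]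
      rw [map_add] at hBq
      rw [← neg_eq_of_add_eq_zero_right hBq, neg_neg]
    have hrange2 : LinearMap.range B ⊔ (ℂ ∙ x₀) ≤ LinearMap.range (B + B₀) :=
      sup_le hrange1 ((Submodule.span_singleton_le_iff_mem _ _).2 ⟨q₀, hx₀val⟩)
    have hinf : LinearMap.range B ⊓ (ℂ ∙ x₀) = ⊥ := by
      rw [eq_bot_iff]
      rintro y ⟨hy1, hy2⟩
      rw [Submodule.mem_bot]
      obtain ⟨c, rfl⟩ := Submodule.mem_span_singleton.1 hy2
      by_cases hc : c = 0
      · rw [hc, zero_smul]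
      · exact absurd (by
          have := Submodule.smul_mem _ c⁻¹ hy1
          rwa [smul_smul, inv_mul_cancel₀ hc, one_smul] at this) hx₀nr
    have hfin : Module.finrank ℂ ↥(LinearMap.range B ⊔ (ℂ ∙ x₀)) = Module.finrank ℂ (LinearMap.range B) + 1 := by
      have h := Submodule.finrank_sup_add_finrank_inf_eq (LinearMap.range B) (ℂ ∙ x₀)
      rw [hinf, finrank_bot, add_zero, finrank_span_singleton hx₀0] at h
      exact h
    have hmono := Submodule.finrank_mono hrange2
    have hle' := hmax (B + B₀) hsum_mem hΘsum hsumΘ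
    rw [hfin] at hmono
    omega
  have hstar' : ∀ B' ∈ 𝔊, Θ * B' = B' → B' * Θ = -B' → ∀ q ∈ Q, B q = 0 → B' q ∈ LinearMap.range B :=
    fun B' hB' h1 h2 q hq hBq => hstar B' hB' h1 h2 q hq hBq ▸ (hD5 _ (hraiseval B' h1 q)).1
  -- STEP 3 (♣)
  have hclub : ∀ B' ∈ 𝔊, Θ * B' = B' → B' * Θ = -B' → ∀ B'' ∈ 𝔊, Θ * B'' = B'' → B'' * Θ = -B'' →
      ∀ q ∈ Q, B q = 0 → D (B' (C (B'' q)) + B'' (C (B' q))) = B' (C (B'' q)) + B'' (C (B' q)) := by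
    intro B' hB' hΘB' hB'Θ B'' hB'' hΘB'' hB''Θ q hq hBq
    set M : Module.End ℂ W := B' * C - C * B' with hMdef
    have hMmem : M ∈ 𝔊 := hbr B' hB' C hC
    have hMΘ : M * Θ = Θ * M := by
      rw [hMdef, sub_mul, mul_sub, mul_assoc, hCΘ, mul_assoc, hB'Θ, ← mul_assoc, hΘB', ← mul_assoc, hΘC, mul_neg,
        neg_mul]
    set R : Module.End ℂ W := M * B'' - B'' * M with hRdef
    have hRmem : R ∈ 𝔊 := hbr M hMmem B'' hB''
    have hΘR : Θ * R = R := by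
      rw [hRdef, mul_sub, ← mul_assoc, ← hMΘ, mul_assoc, hΘB'', ← mul_assoc, hΘB'']
    have hRΘ : R * Θ = -R := by
      rw [hRdef, sub_mul, mul_assoc, hB''Θ, mul_assoc, hMΘ, ← mul_assoc, hB''Θ, mul_neg, neg_mul, neg_sub_neg, neg_sub]
    have h := hstar R hRmem hΘR hRΘ q hq hBq
    have hRq : R q = B' (C (B'' q)) + B'' (C (B' q)) := by
      rw [hRdef, LinearMap.sub_apply, Module.End.mul_apply, Module.End.mul_apply, hMdef, LinearMap.sub_apply,
        LinearMap.sub_apply, Module.End.mul_apply, Module.End.mul_apply, Module.End.mul_apply, Module.End.mul_apply,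
        hraiseP B' hB'Θ _ (hraiseval B'' hΘB'' q), map_zero, sub_zero, hCQ q hq, map_zero, zero_sub, map_neg,
        sub_neg_eq_add]
    rwa [hRq] at h
  -- STEP 4: `P₀ = ℂη`, a basis `e` of `P₁`, coordinates `φⱼ` on `Q₁ = C(P₁)`
  have hfinP₀ : Module.finrank ℂ ↥(P ⊓ LinearMap.ker C) = 1 := by
    have hsup : (P ⊓ LinearMap.ker C) ⊔ LinearMap.range B = P := by
      apply le_antisymm (sup_le inf_le_left hrangeP)
      intro p hp
      obtain ⟨hDp, hCp⟩ := hD5 p hp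
      have h : p = (p - D p) + D p := by abel
      rw [h]
      exact Submodule.add_mem _ (Submodule.mem_sup_left (Submodule.mem_inf.2
        ⟨Submodule.sub_mem _ hp (hrangeP hDp), LinearMap.mem_ker.2 hCp⟩)) (Submodule.mem_sup_right hDp)
    have hinf : (P ⊓ LinearMap.ker C) ⊓ LinearMap.range B = ⊥ := by
      rw [eq_bot_iff]
      rintro x ⟨⟨-, hxC⟩, hxr⟩
      rw [Submodule.mem_bot]
      exact hCinjR x hxr (LinearMap.mem_ker.1 hxC)
    have h := Submodule.finrank_sup_add_finrank_inf_eq (P ⊓ LinearMap.ker C) (LinearMap.range B)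
    rw [hsup, hinf, finrank_bot, add_zero, hrP] at h
    omega
  obtain ⟨⟨η, hηmem⟩, hη0⟩ := Module.finrank_pos_iff_exists_ne_zero.1
    (show 0 < Module.finrank ℂ ↥(P ⊓ LinearMap.ker C) by omega)
  have hη0' : η ≠ 0 := fun h => hη0 (Subtype.ext h)
  obtain ⟨hηP, hηC⟩ := Submodule.mem_inf.1 hηmem
  have hCη : C η = 0 := LinearMap.mem_ker.1 hηC
  have hDη : D η = 0 := hD2 η hηP hCη
  have hΘη : Θ η = η := (hP η).1 hηP
  have hDker : ∀ x ∈ P, D x = 0 → x ∈ ℂ ∙ η := fun x hx hDx =>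
    UnitaryTwoOdd.mem_span_of_finrank_le_one (S := P ⊓ LinearMap.ker C) (by omega) hηmem
      (Submodule.mem_inf.2 ⟨hx, LinearMap.mem_ker.2 (hkerD x hx hDx)⟩) hη0'
  have hηnr : ∀ c : ℂ, c • η ∈ LinearMap.range B → c • η = 0 := fun c h => by
    have h1 := hDfix _ h; rw [map_smul, hDη, smul_zero] at h1; exact h1.symm
  set e := Module.finBasis ℂ ↥(LinearMap.range B) with hedef
  set gC : ↥(LinearMap.range B) →ₗ[ℂ] W := C ∘ₗ (LinearMap.range B).subtype with hgCdef
  have hgCapply : ∀ x : LinearMap.range B, gC x = C x := fun x => rfl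
  have hgCinj : Function.Injective gC := by
    intro x y hxy
    apply Subtype.ext
    have h : C ((x : W) - y) = 0 := by rw [map_sub, sub_eq_zero]; exact hxy
    exact sub_eq_zero.1 (hCinjR _ (Submodule.sub_mem _ x.2 y.2) h)
  obtain ⟨Kc, hKc⟩ := Submodule.exists_isCompl (LinearMap.range gC)
  set proj : W →ₗ[ℂ] ↥(LinearMap.range B) := LinearMap.linearProjOfIsCompl Kc gC hgCinj hKc with hprojdef
  have hproj : ∀ x : LinearMap.range B, proj (C x) = x := fun x =>
    LinearMap.linearProjOfIsCompl_apply_left Kc gC hgCinj hKc x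
  set φ : Fin (Module.finrank ℂ ↥(LinearMap.range B)) → Module.Dual ℂ W := fun j => (e.coord j) ∘ₗ proj with hφdef
  have hφ : ∀ j, ∀ x : LinearMap.range B, φ j (C x) = e.repr x j := fun j x => by
    rw [hφdef]; dsimp only; rw [LinearMap.comp_apply, hproj, Module.Basis.coord_apply]
  -- STEP 5: the involution `Θ' = 2D − Θ` and its Levi instance on `{Θ' = −1} = P₀ ⊕ Q₁`
  set Θ' : Module.End ℂ W := (2 : ℂ) • D - Θ with hΘ'def
  have hΘ'mem : Θ' ∈ 𝔊 := Submodule.sub_mem _ (Submodule.smul_mem _ _ hD) hΘ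
  have hΘ'apply : ∀ w, Θ' w = D w + D w - Θ w := fun w => by
    rw [hΘ'def, LinearMap.sub_apply, LinearMap.smul_apply, two_smul]
  have hΘ'a : ∀ a ∈ LinearMap.range B, Θ' a = a := fun a ha => by
    rw [hΘ'apply, hDfix a ha, (hP a).1 (hrangeP ha)]; abel
  have hΘ'b : ∀ b ∈ P ⊓ LinearMap.ker C, Θ' b = -b := fun b hb => by
    obtain ⟨hbP, hbC⟩ := Submodule.mem_inf.1 hb
    rw [hΘ'apply, hD2 b hbP (LinearMap.mem_ker.1 hbC), (hP b).1 hbP]; abel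
  have hΘ'c : ∀ c ∈ P.map C, Θ' c = -c := fun c hc => by
    obtain ⟨p, hp, rfl⟩ := hc
    rw [hΘ'apply, hD3 p hp, (hQ _).1 (hCmem p)]; abel
  have hΘ'd : ∀ d ∈ Q ⊓ LinearMap.ker B, Θ' d = d := fun d hd => by
    obtain ⟨hdQ, hdB⟩ := Submodule.mem_inf.1 hd
    rw [hΘ'apply, hD4 d hdQ (LinearMap.mem_ker.1 hdB), (hQ d).1 hdQ]; abel
  have hΘ'Θ' : Θ' * Θ' = 1 := by
    refine LinearMap.ext fun w => ?_
    obtain ⟨a, ha, b, hb, c, hc, d, hd, rfl⟩ := hdec w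
    have h1 : Θ' (a + b + c + d) = a - b - c + d := by
      rw [map_add, map_add, map_add, hΘ'a a ha, hΘ'b b hb, hΘ'c c hc, hΘ'd d hd]; abel
    have h2 : Θ' (a - b - c + d) = a + b + c + d := by
      rw [map_add, map_sub, map_sub, hΘ'a a ha, hΘ'b b hb, hΘ'c c hc, hΘ'd d hd]; abel
    rw [Module.End.mul_apply, Module.End.one_apply, h1, h2]
  have h12 : Θ' * Θ = Θ * Θ' := by
    rw [hΘ'def, sub_mul, mul_sub, smul_mul_assoc, mul_smul_comm, hDΘ]
  have hΘ's : ∀ x y, s (Θ' x) y = s x (Θ' y) := fun x y => by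
    rw [hΘ'apply, hΘ'apply, hsubl, hadd, hsubr, haddr, hDs, hΘs]
  set U'' : Submodule ℂ W := LinearMap.ker (Θ' + 1) with hU''def
  have hU'' : ∀ x, x ∈ U'' ↔ Θ' x = -x := fun x => by
    rw [hU''def, LinearMap.mem_ker, LinearMap.add_apply, Module.End.one_apply, add_eq_zero_iff_eq_neg]
  have hPUle : P ⊓ LinearMap.ker C ≤ U'' := fun b hb => (hU'' b).2 (hΘ'b b hb)
  have hQUle : P.map C ≤ U'' := fun c hc => (hU'' c).2 (hΘ'c c hc)
  have hPUmem : ∀ x ∈ U'', Θ x = x → x ∈ P ⊓ LinearMap.ker C := fun x hxU hΘx => by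
    have hxP : x ∈ P := (hP x).2 hΘx
    have h := (hU'' x).1 hxU
    rw [hΘ'apply, hΘx, sub_eq_iff_eq_add, neg_add_cancel, ← two_smul ℂ, smul_eq_zero] at h
    exact Submodule.mem_inf.2 ⟨hxP, LinearMap.mem_ker.2 (hkerD x hxP (h.resolve_left two_ne_zero))⟩
  have hPUΘ : ∀ x ∈ P ⊓ LinearMap.ker C, Θ x = x := fun x hx => (hP x).1 (Submodule.mem_inf.1 hx).1
  have hQUmem : ∀ x ∈ U'', Θ x = -x → x ∈ P.map C := fun x hxU hΘx => by
    have hxQ : x ∈ Q := (hQ x).2 hΘx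
    have h := (hU'' x).1 hxU
    rw [hΘ'apply, hΘx, sub_neg_eq_add, ← sub_eq_zero] at h
    have h' : (2 : ℂ) • (D x + x) = 0 := by rw [two_smul, ← h]; abel
    rw [smul_eq_zero] at h'
    have hDx : D x = -x := eq_neg_of_add_eq_zero_left (h'.resolve_left two_ne_zero)
    have := (hD6 x hxQ).1
    rw [hDx] at this
    simpa using Submodule.neg_mem _ this
  have hQUΘ : ∀ x ∈ P.map C, Θ x = -x := fun x hx => by
    obtain ⟨p, hp, rfl⟩ := hx; exact (hQ _).1 (hCmem p)
  have hPUQU : ∀ x ∈ P ⊓ LinearMap.ker C, ∀ y ∈ P.map C, s x y = 0 := fun x hx y hy => by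
    obtain ⟨p, hp, rfl⟩ := hy; exact hPQ _ (Submodule.mem_inf.1 hx).1 _ (hCmem p)
  have hdefPU : ∀ x ∈ P ⊓ LinearMap.ker C, s x x = 0 → x = 0 := fun x hx h => hdefP x (Submodule.mem_inf.1 hx).1 h
  have hdefQU : ∀ y ∈ P.map C, s y y = 0 → y = 0 := fun y hy h => by
    obtain ⟨p, hp, rfl⟩ := hy; exact hdefQ _ (hCmem p) h
  -- `dim C(P) = r`, `dim (Q ∩ ker B) = dim Q − r`
  have hmapC : P.map C = LinearMap.range gC := by
    apply le_antisymm
    · rintro _ ⟨p, hp, rfl⟩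
      exact ⟨⟨D p, (hD5 p hp).1⟩, by rw [hgCapply, ← hCD p hp]⟩
    · rintro _ ⟨x, rfl⟩
      exact ⟨x, hrangeP x.2, rfl⟩
  have hfinQU : Module.finrank ℂ ↥(P.map C) = Module.finrank ℂ (LinearMap.range B) := by
    rw [hmapC, LinearMap.finrank_range_of_inj hgCinj]
  have hfinQ₀ : Module.finrank ℂ ↥(Q ⊓ LinearMap.ker B) + Module.finrank ℂ (LinearMap.range B) =
      Module.finrank ℂ Q := by
    have hsup : (Q ⊓ LinearMap.ker B) ⊔ P.map C = Q := by
      apply le_antisymm (sup_le inf_le_left (by rintro _ ⟨p, hp, rfl⟩; exact hCmem p))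
      intro q hq
      obtain ⟨hDq, hBq⟩ := hD6 q hq
      have h : q = (q + D q) + (-(D q)) := by abel
      rw [h]
      refine Submodule.add_mem _ (Submodule.mem_sup_left (Submodule.mem_inf.2 ⟨Submodule.add_mem _ hq ?_,
        LinearMap.mem_ker.2 hBq⟩)) (Submodule.mem_sup_right (Submodule.neg_mem _ hDq))
      obtain ⟨p, hp, hpq⟩ := hDq
      rw [← hpq]; exact hCmem p
    have hinf : (Q ⊓ LinearMap.ker B) ⊓ P.map C = ⊥ := by
      rw [eq_bot_iff]
      rintro x ⟨⟨-, hxB⟩, ⟨p, hp, rfl⟩⟩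
      rw [Submodule.mem_bot]
      exact hpos1 p hp (LinearMap.mem_ker.1 hxB)
    have h := Submodule.finrank_sup_add_finrank_inf_eq (Q ⊓ LinearMap.ker B) (P.map C)
    rw [hsup, hinf, finrank_bot, add_zero, hfinQU] at h
    exact h.symm
  -- the Levi instance: every endomorphism of `U''` is a restriction
  have hLevi := UnitaryThreeCoprime.levi_instance hbr hirr hΘΘ hP hQ hadd hsymm hPQ hdefP hdefQ hadj hΘ'mem hΘ'Θ'
    hΘ's hΘ hΘΘ h12 hU'' hPUle hQUle hPUmem hPUΘ hQUmem hQUΘ hPUQU hdefPU hdefQU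
    (fun 𝔩 ι P' Q' hbr𝔩 hirr𝔩 hι hιι hP' hQ' hfinP' hfinQ' _ _ _ _ =>
      UnitaryThreeCoprime.eq_top_of_finrank_eq_one hbr𝔩 hirr𝔩 (Submodule.neg_mem _ hι)
        (UnitaryRaisingRank.neg_mul_neg_eq_one_of hιι)
        (P := Q') (Q := P') (fun x => by rw [hQ', LinearMap.neg_apply, neg_eq_iff_eq_neg])
        (fun x => by rw [hP', LinearMap.neg_apply, neg_inj]) (by rw [hfinQ', hfinQU]; exact hr2) (by rw [hfinP', hfinP₀]))
  -- STEP 6: the raising operators `B₁, B₂` with `Bⱼ(C x) = eⱼ^*(x) η`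
  set ηU : U'' := ⟨η, hPUle hηmem⟩ with hηUdef
  have hZex : ∀ j : Fin (Module.finrank ℂ ↥(LinearMap.range B)), ∃ Z ∈ 𝔊, Z * Θ' = Θ' * Z ∧
      ∀ x : U'', ((((φ j) ∘ₗ U''.subtype).smulRight ηU x : U'') : W) = Z x := fun j => hLevi _
  choose Z hZmem hZΘ' hZval using hZex
  have hZval' : ∀ j, ∀ x ∈ U'', Z j x = (φ j x) • η := fun j x hx => by
    have h := hZval j ⟨x, hx⟩
    rw [LinearMap.smulRight_apply, LinearMap.comp_apply, Submodule.subtype_apply, Submodule.coe_smul] at h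
    exact h.symm
  obtain ⟨Bj, hBjdef⟩ : ∃ Bj : Fin (Module.finrank ℂ ↥(LinearMap.range B)) → Module.End ℂ W,
      ∀ j, Bj j = (4 : ℂ)⁻¹ • (Z j + Θ * Z j - Z j * Θ - Θ * Z j * Θ) := ⟨_, fun j => rfl⟩
  have hBjrel : ∀ j, Bj j ∈ 𝔊 ∧ Θ * Bj j = Bj j ∧ Bj j * Θ = -(Bj j) := fun j => by
    rw [hBjdef j]; exact UnitaryThetaCore.raise_relations hbr hΘ hΘΘ (hZmem j)
  have hBjval : ∀ j, ∀ v ∈ P.map C, Bj j v = (φ j v) • η := fun j v hv => by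
    have hvQ : Θ v = -v := hQUΘ v hv
    have hZv : Z j v = (φ j v) • η := hZval' j v (hQUle hv)
    have hΘZv : Θ (Z j v) = Z j v := by rw [hZv, map_smul, hΘη]
    rw [hBjdef j, LinearMap.smul_apply, LinearMap.sub_apply, LinearMap.sub_apply, LinearMap.add_apply,
      Module.End.mul_apply, Module.End.mul_apply, Module.End.mul_apply, Module.End.mul_apply, hvQ, map_neg, map_neg,
      hΘZv, ← hZv]
    module
  have hBjC : ∀ j, ∀ x : LinearMap.range B, Bj j (C x) = (e.repr x j) • η := fun j x => by
    rw [hBjval j _ ⟨x, hrangeP x.2, rfl⟩, hφ]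
  have hBjQ₀ : ∀ j, ∀ q ∈ Q, B q = 0 → Bj j q ∈ LinearMap.range B := fun j q hq hBq =>
    hstar' (Bj j) (hBjrel j).1 (hBjrel j).2.1 (hBjrel j).2.2 q hq hBq
  -- coordinates vanish ⟹ vector vanishes
  have hrepr0 : ∀ x : LinearMap.range B, (∀ j, e.repr x j = 0) → (x : W) = 0 := fun x h => by
    have hx : x = 0 := e.forall_coord_eq_zero_iff.1 fun j => by rw [Module.Basis.coord_apply]; exact h j
    rw [hx, Submodule.coe_zero]
  -- relations (♣) for `Bⱼ, Bₖ`
  have hrel : ∀ j k, ∀ q (hq : q ∈ Q) (hBq : B q = 0),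
      e.repr ⟨Bj k q, hBjQ₀ k q hq hBq⟩ j + e.repr ⟨Bj j q, hBjQ₀ j q hq hBq⟩ k = 0 := by
    intro j k q hq hBq
    have h := hclub (Bj j) (hBjrel j).1 (hBjrel j).2.1 (hBjrel j).2.2 (Bj k) (hBjrel k).1 (hBjrel k).2.1
      (hBjrel k).2.2 q hq hBq
    have h1 : Bj j (C (Bj k q)) = (e.repr ⟨Bj k q, hBjQ₀ k q hq hBq⟩ j) • η := hBjC j ⟨Bj k q, hBjQ₀ k q hq hBq⟩
    have h2 : Bj k (C (Bj j q)) = (e.repr ⟨Bj j q, hBjQ₀ j q hq hBq⟩ k) • η := hBjC k ⟨Bj j q, hBjQ₀ j q hq hBq⟩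
    rw [h1, h2, ← add_smul, map_smul, hDη, smul_zero] at h
    exact (smul_eq_zero.1 h.symm).resolve_right hη0'
  -- STEP 7: a raising operator mapping `Q₁ = C(P)` into `P₁` kills `Q₀`; in particular, once `Bⱼ q = 0` for all `j`,
  -- every raising operator kills `q`
  have hkill_of : ∀ q ∈ Q, B q = 0 → (∀ j, Bj j q = 0) → ∀ B' ∈ 𝔊, Θ * B' = B' → B' * Θ = -B' → B' q = 0 := by
    intro q hq hBq hBjq B' hB' hΘB' hB'Θ
    have hyr : B' q ∈ LinearMap.range B := hstar' B' hB' hΘB' hB'Θ q hq hBq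
    set y : LinearMap.range B := ⟨B' q, hyr⟩ with hydef
    have hcoord : ∀ j, e.repr y j = 0 := fun j => by
      have h := hclub B' hB' hΘB' hB'Θ (Bj j) (hBjrel j).1 (hBjrel j).2.1 (hBjrel j).2.2 q hq hBq
      have h1 : Bj j (C (B' q)) = (e.repr y j) • η := hBjC j y
      rw [hBjq j, map_zero, map_zero, zero_add, h1, map_smul, hDη, smul_zero] at h
      exact (smul_eq_zero.1 h.symm).resolve_right hη0'
    exact hrepr0 y hcoord
  -- STEP 8: counting — a non-zero `q ∈ Q₀` with all the (skew) coefficients `eᵢ^*(Bⱼ q)` zero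
  set Q₀ : Submodule ℂ W := Q ⊓ LinearMap.ker B with hQ₀def
  set ι₂ := {p : Fin (Module.finrank ℂ ↥(LinearMap.range B)) × Fin (Module.finrank ℂ ↥(LinearMap.range B)) // p.1 < p.2}
  have hBjQ₀' : ∀ j, ∀ q : ↥Q₀, Bj j q ∈ LinearMap.range B := fun j q =>
    hBjQ₀ j q (Submodule.mem_inf.1 q.2).1 (LinearMap.mem_ker.1 (Submodule.mem_inf.1 q.2).2)
  set Λ : ↥Q₀ →ₗ[ℂ] (ι₂ → ℂ) :=
    { toFun := fun q p => φ p.1.1 (C (Bj p.1.2 q))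
      map_add' := fun q q' => by
        funext p
        simp only [Submodule.coe_add, map_add, Pi.add_apply]
      map_smul' := fun c q => by
        funext p
        simp only [Submodule.coe_smul, map_smul, smul_eq_mul, Pi.smul_apply, RingHom.id_apply] } with hΛdef
  have hΛapply : ∀ (q : ↥Q₀) (p : ι₂), Λ q p = φ p.1.1 (C (Bj p.1.2 q)) := fun q p => rfl
  have hrQ' : Fintype.card ι₂ + Module.finrank ℂ (LinearMap.range B) < Module.finrank ℂ Q := by
    have h := UnitaryRaisingRank.card_pairs_lt (Module.finrank ℂ ↥(LinearMap.range B))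
    change Fintype.card ι₂ = _ at h
    rw [h]; exact hrQ
  have hΛker : LinearMap.ker Λ ≠ ⊥ :=
    LinearMap.ker_ne_bot_of_finrank_lt (by rw [Module.finrank_fintype_fun_eq_card]; omega)
  obtain ⟨⟨q, hqQ₀⟩, hqker, hq0⟩ := (Submodule.ne_bot_iff _).1 hΛker
  obtain ⟨hqQ, hqB⟩ := Submodule.mem_inf.1 hqQ₀
  have hBq : B q = 0 := LinearMap.mem_ker.1 hqB
  have hq0' : q ≠ 0 := fun h => hq0 (Subtype.ext h)
  have hcoef_lt : ∀ i j, i < j → e.repr ⟨Bj j q, hBjQ₀ j q hqQ hBq⟩ i = 0 := fun i j hij => by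
    have h := congrFun (LinearMap.mem_ker.1 hqker) ⟨(i, j), hij⟩
    rw [hΛapply, Pi.zero_apply] at h
    rw [← hφ i ⟨Bj j q, hBjQ₀ j q hqQ hBq⟩]
    exact h
  have hcoef : ∀ i j, e.repr ⟨Bj j q, hBjQ₀ j q hqQ hBq⟩ i = 0 := by
    intro i j
    rcases lt_trichotomy i j with hij | rfl | hji
    · exact hcoef_lt i j hij
    · have h := hrel i i q hqQ hBq
      rw [← two_mul, mul_eq_zero] at h
      exact h.resolve_left two_ne_zero
    · have h := hrel i j q hqQ hBq
      rw [hcoef_lt j i hji, add_zero] at h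
      exact h
  have hBjq : ∀ j, Bj j q = 0 := fun j => hrepr0 ⟨Bj j q, hBjQ₀ j q hqQ hBq⟩ fun i => hcoef i j
  exact hq0' (UnitaryThetaCore.eq_zero_of_forall_raise_apply_eq_zero hbr hirr hΘ hΘΘ hP0 ((hQ q).1 hqQ)
    fun B' hB' hΘB' hB'Θ => hkill_of q hqQ hBq hBjq B' hB' hΘB' hB'Θ)

/-! ### The Ψ-route with `dim P ≥ r + 2` (a core hypothesis, no counting) -/

/-- **The raising-rank lemma, Ψ-route with `dim P ≥ r + 2`.** Setting of the unitary cores; `B ∈ 𝔊` raising of rank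
`r ≥ 2` with `dim P ≥ r + 2`, `dim Q ≥ r + 1`, and the abstract core of type `(dim P − r | r)` (hypothesis-schema
`hcore`, as in `UnitaryThreeCoprime.levi_instance`, for the Levi instance on `P₀ ⊕ Q₁`). Then some raising operator
has rank `> r`. PROOF: realise the rank-one maps `e_j^* ⊗ η : Q₁ → P₀` (`η ∈ P₀`) as `Q₁`-restrictions of raising
`B_{j,η} ∈ 𝔊`; with `η₀, η₁ ∈ P₀` independent, (♣) for `(B_{j,η₀}, B_{i,η₁})` at `q ∈ Q₀` reads
`e_j^*(B_{i,η₁}q) η₀ + e_i^*(B_{j,η₀}q) η₁ ∈ P₁ ∩ P₀ = 0`, so `B_{j,η₀}` kills `Q₀`; then (♣) for `(B', B_{i,η₀})` gives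
`e_i^*(B'q) η₀ = 0`, so EVERY raising operator kills `Q₀ ≠ 0` — contradicting the covering lemma. No counting.
[cite: Ribet1983, Thm. 3] [cite: Deligne1982HodgeCycles, I §3 Prop. 3.6] [cite: GoodmanWallachGTM255, §4.1.1] -/
theorem UnitaryRaisingRank.exists_raise_rank_gt_of_psi_core [FiniteDimensional ℂ W] {𝔊 : Submodule ℂ (Module.End ℂ W)}
    (hbr : ∀ Y ∈ 𝔊, ∀ Z ∈ 𝔊, Y * Z - Z * Y ∈ 𝔊)
    (hirr : ∀ U : Submodule ℂ W, (∀ A ∈ 𝔊, ∀ u ∈ U, A u ∈ U) → U = ⊥ ∨ U = ⊤)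
    {Θ : Module.End ℂ W} (hΘ : Θ ∈ 𝔊) (hΘΘ : Θ * Θ = 1)
    {P Q : Submodule ℂ W} (hP : ∀ x, x ∈ P ↔ Θ x = x) (hQ : ∀ x, x ∈ Q ↔ Θ x = -x)
    {B : Module.End ℂ W} (hB : B ∈ 𝔊) (hΘB : Θ * B = B) (hBΘ : B * Θ = -B)
    (hr1 : 1 ≤ Module.finrank ℂ (LinearMap.range B))
    (hrP : Module.finrank ℂ (LinearMap.range B) + 2 ≤ Module.finrank ℂ P)
    (hrQ : Module.finrank ℂ (LinearMap.range B) + 1 ≤ Module.finrank ℂ Q)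
    {s : W → W → ℂ} (hadd : ∀ x y z, s (x + y) z = s x z + s y z) (hsymm : ∀ x y, s y x = starRingEnd ℂ (s x y))
    (hPQ : ∀ p ∈ P, ∀ q ∈ Q, s p q = 0) (hdefP : ∀ p ∈ P, s p p = 0 → p = 0) (hdefQ : ∀ q ∈ Q, s q q = 0 → q = 0)
    (hadj : ∀ X ∈ 𝔊, ∃ Y ∈ 𝔊, ∀ x y, s (X x) y = s x (Y y))
    (hcore : ∀ (U : Submodule ℂ W) (𝔩 : Submodule ℂ (Module.End ℂ U)) (ι : Module.End ℂ U) (P' Q' : Submodule ℂ U),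
      (∀ A ∈ 𝔩, ∀ A' ∈ 𝔩, A * A' - A' * A ∈ 𝔩) →
      (∀ V : Submodule ℂ U, (∀ A ∈ 𝔩, ∀ u ∈ V, A u ∈ V) → V = ⊥ ∨ V = ⊤) →
      ι ∈ 𝔩 → ι * ι = 1 → (∀ x, x ∈ P' ↔ ι x = x) → (∀ x, x ∈ Q' ↔ ι x = -x) →
      Module.finrank ℂ P' + Module.finrank ℂ (LinearMap.range B) = Module.finrank ℂ P →
      Module.finrank ℂ Q' = Module.finrank ℂ (LinearMap.range B) →
      (∀ p ∈ P', ∀ q ∈ Q', s (p : W) q = 0) → (∀ p ∈ P', s (p : W) p = 0 → p = 0) →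
      (∀ q ∈ Q', s (q : W) q = 0 → q = 0) →
      (∀ A ∈ 𝔩, ∃ A' ∈ 𝔩, ∀ x y : U, s ((A x : U) : W) y = s x ((A' y : U) : W)) → 𝔩 = ⊤) :
    ∃ B' ∈ 𝔊, Θ * B' = B' ∧ B' * Θ = -B' ∧
      Module.finrank ℂ (LinearMap.range B) < Module.finrank ℂ (LinearMap.range B') := by
  classical
  obtain ⟨haddr, h0r, h0l, hnegr, hnegl, hsubr, hsubl⟩ := UnitaryTwoOdd.herm_right hadd hsymm
  have hΘΘv : ∀ v, Θ (Θ v) = v := fun v => by rw [← Module.End.mul_apply, hΘΘ, Module.End.one_apply]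
  have hPhat : ∀ w, (2 : ℂ)⁻¹ • (w + Θ w) ∈ P := fun w => (hP _).2 (by rw [map_smul, map_add, hΘΘv, add_comm])
  have hQhat : ∀ w, (2 : ℂ)⁻¹ • (w - Θ w) ∈ Q := fun w =>
    (hQ _).2 (by rw [map_smul, map_sub, hΘΘv, ← smul_neg, neg_sub])
  have hsplit : ∀ w, (2 : ℂ)⁻¹ • (w + Θ w) + (2 : ℂ)⁻¹ • (w - Θ w) = w := fun w => by module
  have hP0 : ∃ p : W, p ≠ 0 ∧ Θ p = p := by
    obtain ⟨⟨p, hp⟩, hp0⟩ := Module.finrank_pos_iff_exists_ne_zero.1 (show 0 < Module.finrank ℂ P by omega)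
    exact ⟨p, fun h => hp0 (Subtype.ext h), (hP p).1 hp⟩
  have hraiseval : ∀ Z : Module.End ℂ W, Θ * Z = Z → ∀ w, Z w ∈ P := fun Z hΘZ w =>
    (hP _).2 (by rw [← Module.End.mul_apply, hΘZ])
  have hraiseP : ∀ Z : Module.End ℂ W, Z * Θ = -Z → ∀ p ∈ P, Z p = 0 := fun Z hZΘ p hp => by
    have h : Z p = -(Z p) := by
      conv_lhs => rw [← (hP p).1 hp]
      rw [← Module.End.mul_apply, hZΘ, LinearMap.neg_apply]
    have h2 : (2 : ℂ) • Z p = 0 := by rw [two_smul]; nth_rewrite 2 [h]; rw [add_neg_cancel]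
    exact (smul_eq_zero.1 h2).resolve_left two_ne_zero
  have hΘs := UnitaryTwoOdd.theta_selfAdjoint hadd hsymm hΘΘ hP hQ hPQ
  by_contra hcon
  push Not at hcon
  have hmax : ∀ B' ∈ 𝔊, Θ * B' = B' → B' * Θ = -B' →
      Module.finrank ℂ (LinearMap.range B') ≤ Module.finrank ℂ (LinearMap.range B) := hcon
  -- STEP 1: `B`, its adjoint `C` and the projector pair `D`
  have hBmem : ∀ w, B w ∈ P := hraiseval B hΘB
  have hBP : ∀ p ∈ P, B p = 0 := hraiseP B hBΘ
  have hrangeP : LinearMap.range B ≤ P := by rintro _ ⟨w, rfl⟩; exact hBmem w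
  obtain ⟨C, hC, hBC⟩ := hadj B hB
  obtain ⟨hΘC, hCΘ⟩ := UnitaryTwoOdd.lower_of_adjoint hadd hsymm hΘΘ hP hQ hPQ hdefP hdefQ hΘB hBΘ hBC
  have hCmem : ∀ w, C w ∈ Q := fun w => (hQ _).2 (by rw [← Module.End.mul_apply, hΘC, LinearMap.neg_apply])
  have hCQ : ∀ q ∈ Q, C q = 0 := fun q hq => by
    have h : C q = -(C q) := by
      conv_lhs => rw [← neg_neg q, ← (hQ q).1 hq, map_neg, ← Module.End.mul_apply, hCΘ]
    have h2 : (2 : ℂ) • C q = 0 := by rw [two_smul]; nth_rewrite 2 [h]; rw [add_neg_cancel]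
    exact (smul_eq_zero.1 h2).resolve_left two_ne_zero
  obtain ⟨D, hD, hDΘ, hD1, hD2, hD3, hD4, hD5, hD6, hpos1, hpos2, hdec, hDs⟩ :=
    UnitaryThreeCoprime.exists_projector_pair hbr hΘΘ hP hQ hadd hsymm hPQ hdefP hdefQ hB hC hΘB hBΘ hBC
  have hDP : ∀ p ∈ P, D p ∈ P := fun p hp => hrangeP (hD5 p hp).1
  have hDfix : ∀ x ∈ LinearMap.range B, D x = x := by rintro _ ⟨w, rfl⟩; exact hD1 w
  have hDDP : ∀ p ∈ P, D (D p) = D p := fun p hp => hDfix _ (hD5 p hp).1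
  have hkerD : ∀ p ∈ P, D p = 0 → C p = 0 := fun p hp h => by
    have h' := (hD5 p hp).2; rwa [h, sub_zero] at h'
  have hCinjR : ∀ x ∈ LinearMap.range B, C x = 0 → x = 0 := by rintro _ ⟨w, rfl⟩ h; exact hpos2 w h
  have hCD : ∀ p ∈ P, C p = C (D p) := fun p hp => by
    have h := (hD5 p hp).2; rw [map_sub, sub_eq_zero] at h; exact h
  -- STEP 2 (★): every raising operator maps `Q₀ = Q ∩ ker B` into `P₁ = B(W)`
  have hcommbr : ∀ X : Module.End ℂ W, Θ * X = X → X * Θ = -X →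
      Θ * (D * X - X * D) = D * X - X * D ∧ (D * X - X * D) * Θ = -(D * X - X * D) := fun X h1 h2 =>
    ⟨by rw [mul_sub, ← mul_assoc, ← hDΘ, mul_assoc, h1, ← mul_assoc, h1],
     by rw [sub_mul, mul_assoc, h2, mul_assoc, hDΘ, ← mul_assoc, h2, mul_neg, neg_mul, neg_sub_neg, neg_sub]⟩
  have hstar : ∀ B' ∈ 𝔊, Θ * B' = B' → B' * Θ = -B' → ∀ q ∈ Q, B q = 0 → D (B' q) = B' q := by
    intro B' hB' hΘB' hB'Θ
    by_contra hne
    push Not at hne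
    obtain ⟨q₀, hq₀Q, hBq₀, hneq⟩ := hne
    have hB'P : ∀ p ∈ P, B' p = 0 := hraiseP B' hB'Θ
    have hB'mem : ∀ w, B' w ∈ P := hraiseval B' hΘB'
    set N : Module.End ℂ W := D * B' - B' * D with hNdef
    obtain ⟨hΘN, hNΘ⟩ : Θ * N = N ∧ N * Θ = -N := hcommbr B' hΘB' hB'Θ
    set N₂ : Module.End ℂ W := D * N - N * D with hN₂def
    obtain ⟨hΘN₂, hN₂Θ⟩ : Θ * N₂ = N₂ ∧ N₂ * Θ = -N₂ := hcommbr N hΘN hNΘ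
    have hNmem : N ∈ 𝔊 := hbr D hD B' hB'
    have hN₂mem : N₂ ∈ 𝔊 := hbr D hD N hNmem
    set B₀ : Module.End ℂ W := (2 : ℂ)⁻¹ • (N₂ - (3 : ℂ) • N + (2 : ℂ) • B') with hB₀def
    have hB₀mem : B₀ ∈ 𝔊 := Submodule.smul_mem _ _ (Submodule.add_mem _ (Submodule.sub_mem _ hN₂mem
      (Submodule.smul_mem _ _ hNmem)) (Submodule.smul_mem _ _ hB'))
    have hΘB₀ : Θ * B₀ = B₀ := by
      rw [hB₀def, mul_smul_comm, mul_add, mul_sub, mul_smul_comm, mul_smul_comm, hΘN₂, hΘN, hΘB']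
    have hB₀Θ : B₀ * Θ = -B₀ := by
      rw [hB₀def, smul_mul_assoc, add_mul, sub_mul, smul_mul_assoc, smul_mul_assoc, hN₂Θ, hNΘ, hB'Θ]
      module
    -- values of `N`, `N₂`, `B₀`
    have hNq : ∀ q ∈ Q, B q = 0 → N q = D (B' q) := fun q hq hBq => by
      rw [hNdef, LinearMap.sub_apply, Module.End.mul_apply, Module.End.mul_apply, hD4 q hq hBq, map_zero, sub_zero]
    have hNP : ∀ p ∈ P, N p = 0 := fun p hp => by
      rw [hNdef, LinearMap.sub_apply, Module.End.mul_apply, Module.End.mul_apply, hB'P p hp, map_zero,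
        hB'P _ (hDP p hp), sub_zero]
    have hNC : ∀ p ∈ P, N (C p) = D (B' (C p)) + B' (C p) := fun p hp => by
      rw [hNdef, LinearMap.sub_apply, Module.End.mul_apply, Module.End.mul_apply, hD3 p hp, map_neg, sub_neg_eq_add]
    have hN₂q : ∀ q ∈ Q, B q = 0 → N₂ q = D (B' q) := fun q hq hBq => by
      rw [hN₂def, LinearMap.sub_apply, Module.End.mul_apply, Module.End.mul_apply, hNq q hq hBq, hD4 q hq hBq,
        map_zero, sub_zero, hDDP _ (hB'mem q)]
    have hN₂C : ∀ p ∈ P, N₂ (C p) = D (B' (C p)) + D (B' (C p)) + (D (B' (C p)) + B' (C p)) := fun p hp => by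
      rw [hN₂def, LinearMap.sub_apply, Module.End.mul_apply, Module.End.mul_apply, hNC p hp, hD3 p hp, map_neg,
        hNC p hp, map_add, hDDP _ (hB'mem _), sub_neg_eq_add]
    have hB₀q : ∀ q ∈ Q, B q = 0 → B₀ q = B' q - D (B' q) := fun q hq hBq => by
      rw [hB₀def, LinearMap.smul_apply, LinearMap.add_apply, LinearMap.sub_apply, LinearMap.smul_apply,
        LinearMap.smul_apply, hN₂q q hq hBq, hNq q hq hBq]
      module
    have hB₀C : ∀ p ∈ P, B₀ (C p) = 0 := fun p hp => by
      rw [hB₀def, LinearMap.smul_apply, LinearMap.add_apply, LinearMap.sub_apply, LinearMap.smul_apply,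
        LinearMap.smul_apply, hN₂C p hp, hNC p hp]
      module
    -- `B + B₀` is raising and maps onto `P`
    have hsum_mem : B + B₀ ∈ 𝔊 := Submodule.add_mem _ hB hB₀mem
    have hΘsum : Θ * (B + B₀) = B + B₀ := by rw [mul_add, hΘB, hΘB₀]
    have hsumΘ : (B + B₀) * Θ = -(B + B₀) := by rw [add_mul, hBΘ, hB₀Θ, neg_add]
    set x₀ := B' q₀ - D (B' q₀) with hx₀def
    have hx₀P : x₀ ∈ P := Submodule.sub_mem _ (hB'mem q₀) (hDP _ (hB'mem q₀))
    have hx₀0 : x₀ ≠ 0 := fun h => hneq (by rw [hx₀def, sub_eq_zero] at h; exact h.symm)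
    have hx₀nr : x₀ ∉ LinearMap.range B := fun h => by
      have h1 := hDfix x₀ h
      rw [hx₀def, map_sub, hDDP _ (hB'mem q₀), sub_self] at h1
      exact hx₀0 h1.symm
    have hx₀val : (B + B₀) q₀ = x₀ := by
      rw [LinearMap.add_apply, hBq₀, zero_add, hB₀q q₀ hq₀Q hBq₀]
    have hrange1 : LinearMap.range B ≤ LinearMap.range (B + B₀) := by
      rintro _ ⟨w, rfl⟩
      set q := (2 : ℂ)⁻¹ • (w - Θ w) with hqdef
      obtain ⟨hDq, hBq⟩ := hD6 q (hQhat w)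
      obtain ⟨p', hp', hp'q⟩ := hDq
      refine ⟨-(D q), ?_⟩
      have hBw : B w = B q := by
        conv_lhs => rw [← hsplit w, map_add, hBP _ (hPhat w), zero_add]
      rw [LinearMap.add_apply, map_neg, map_neg, ← hp'q, hB₀C p' hp', neg_zero, add_zero, hp'q, hBw]
      rw [map_add] at hBq
      rw [← neg_eq_of_add_eq_zero_right hBq, neg_neg]
    have hrange2 : LinearMap.range B ⊔ (ℂ ∙ x₀) ≤ LinearMap.range (B + B₀) :=
      sup_le hrange1 ((Submodule.span_singleton_le_iff_mem _ _).2 ⟨q₀, hx₀val⟩)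
    have hinf : LinearMap.range B ⊓ (ℂ ∙ x₀) = ⊥ := by
      rw [eq_bot_iff]
      rintro y ⟨hy1, hy2⟩
      rw [Submodule.mem_bot]
      obtain ⟨c, rfl⟩ := Submodule.mem_span_singleton.1 hy2
      by_cases hc : c = 0
      · rw [hc, zero_smul]
      · exact absurd (by
          have := Submodule.smul_mem _ c⁻¹ hy1
          rwa [smul_smul, inv_mul_cancel₀ hc, one_smul] at this) hx₀nr
    have hfin : Module.finrank ℂ ↥(LinearMap.range B ⊔ (ℂ ∙ x₀)) = Module.finrank ℂ (LinearMap.range B) + 1 := by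
      have h := Submodule.finrank_sup_add_finrank_inf_eq (LinearMap.range B) (ℂ ∙ x₀)
      rw [hinf, finrank_bot, add_zero, finrank_span_singleton hx₀0] at h
      exact h
    have hmono := Submodule.finrank_mono hrange2
    have hle' := hmax (B + B₀) hsum_mem hΘsum hsumΘ
    rw [hfin] at hmono
    omega
  have hstar' : ∀ B' ∈ 𝔊, Θ * B' = B' → B' * Θ = -B' → ∀ q ∈ Q, B q = 0 → B' q ∈ LinearMap.range B :=
    fun B' hB' h1 h2 q hq hBq => hstar B' hB' h1 h2 q hq hBq ▸ (hD5 _ (hraiseval B' h1 q)).1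
  -- STEP 3 (♣)
  have hclub : ∀ B' ∈ 𝔊, Θ * B' = B' → B' * Θ = -B' → ∀ B'' ∈ 𝔊, Θ * B'' = B'' → B'' * Θ = -B'' →
      ∀ q ∈ Q, B q = 0 → D (B' (C (B'' q)) + B'' (C (B' q))) = B' (C (B'' q)) + B'' (C (B' q)) := by
    intro B' hB' hΘB' hB'Θ B'' hB'' hΘB'' hB''Θ q hq hBq
    set M : Module.End ℂ W := B' * C - C * B' with hMdef
    have hMmem : M ∈ 𝔊 := hbr B' hB' C hC
    have hMΘ : M * Θ = Θ * M := by
      rw [hMdef, sub_mul, mul_sub, mul_assoc, hCΘ, mul_assoc, hB'Θ, ← mul_assoc, hΘB', ← mul_assoc, hΘC, mul_neg,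
        neg_mul]
    set R : Module.End ℂ W := M * B'' - B'' * M with hRdef
    have hRmem : R ∈ 𝔊 := hbr M hMmem B'' hB''
    have hΘR : Θ * R = R := by
      rw [hRdef, mul_sub, ← mul_assoc, ← hMΘ, mul_assoc, hΘB'', ← mul_assoc, hΘB'']
    have hRΘ : R * Θ = -R := by
      rw [hRdef, sub_mul, mul_assoc, hB''Θ, mul_assoc, hMΘ, ← mul_assoc, hB''Θ, mul_neg, neg_mul, neg_sub_neg, neg_sub]
    have h := hstar R hRmem hΘR hRΘ q hq hBq
    have hRq : R q = B' (C (B'' q)) + B'' (C (B' q)) := by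
      rw [hRdef, LinearMap.sub_apply, Module.End.mul_apply, Module.End.mul_apply, hMdef, LinearMap.sub_apply,
        LinearMap.sub_apply, Module.End.mul_apply, Module.End.mul_apply, Module.End.mul_apply, Module.End.mul_apply,
        hraiseP B' hB'Θ _ (hraiseval B'' hΘB'' q), map_zero, sub_zero, hCQ q hq, map_zero, zero_sub, map_neg,
        sub_neg_eq_add]
    rwa [hRq] at h
  -- STEP 4: `P₀ = ℂη`, a basis `e` of `P₁`, coordinates `φⱼ` on `Q₁ = C(P₁)`
  have hfinP₀ : Module.finrank ℂ ↥(P ⊓ LinearMap.ker C) + Module.finrank ℂ (LinearMap.range B) =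
      Module.finrank ℂ P := by
    have hsup : (P ⊓ LinearMap.ker C) ⊔ LinearMap.range B = P := by
      apply le_antisymm (sup_le inf_le_left hrangeP)
      intro p hp
      obtain ⟨hDp, hCp⟩ := hD5 p hp
      have h : p = (p - D p) + D p := by abel
      rw [h]
      exact Submodule.add_mem _ (Submodule.mem_sup_left (Submodule.mem_inf.2
        ⟨Submodule.sub_mem _ hp (hrangeP hDp), LinearMap.mem_ker.2 hCp⟩)) (Submodule.mem_sup_right hDp)
    have hinf : (P ⊓ LinearMap.ker C) ⊓ LinearMap.range B = ⊥ := by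
      rw [eq_bot_iff]
      rintro x ⟨⟨-, hxC⟩, hxr⟩
      rw [Submodule.mem_bot]
      exact hCinjR x hxr (LinearMap.mem_ker.1 hxC)
    have h := Submodule.finrank_sup_add_finrank_inf_eq (P ⊓ LinearMap.ker C) (LinearMap.range B)
    rw [hsup, hinf, finrank_bot, add_zero] at h
    exact h.symm
  -- `P₀ = P ∩ ker C` has dimension `≥ 2`: two independent vectors `η₀, η₁`
  have hfinP₀' : 2 ≤ Module.finrank ℂ ↥(P ⊓ LinearMap.ker C) := by omega
  set fP := Module.finBasis ℂ ↥(P ⊓ LinearMap.ker C) with hfPdef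
  set k₀ : Fin (Module.finrank ℂ ↥(P ⊓ LinearMap.ker C)) := ⟨0, by omega⟩ with hk₀def
  set k₁ : Fin (Module.finrank ℂ ↥(P ⊓ LinearMap.ker C)) := ⟨1, by omega⟩ with hk₁def
  have hk01 : k₀ ≠ k₁ := fun h => by
    have := congrArg Fin.val h
    rw [hk₀def, hk₁def] at this
    exact absurd this (by norm_num)
  have hηfacts : ∀ η ∈ P ⊓ LinearMap.ker C, C η = 0 ∧ D η = 0 ∧ Θ η = η := fun η hη => by
    obtain ⟨hηP, hηC⟩ := Submodule.mem_inf.1 hη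
    exact ⟨LinearMap.mem_ker.1 hηC, hD2 η hηP (LinearMap.mem_ker.1 hηC), (hP η).1 hηP⟩
  have hindep : ∀ c₀ c₁ : ℂ, c₀ • ((fP k₀ : ↥(P ⊓ LinearMap.ker C)) : W) + c₁ • ((fP k₁ : ↥(P ⊓ LinearMap.ker C)) : W) = 0 →
      c₀ = 0 ∧ c₁ = 0 := by
    intro c₀ c₁ h
    have h' : c₀ • fP k₀ + c₁ • fP k₁ = 0 := by
      apply Subtype.ext
      rw [Submodule.coe_add, Submodule.coe_smul, Submodule.coe_smul, Submodule.coe_zero]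
      exact h
    have h0 := congrArg (fun v => fP.repr v k₀) h'
    have h1 := congrArg (fun v => fP.repr v k₁) h'
    simp only [map_add, map_smul, fP.repr_self, Finsupp.coe_add, Finsupp.coe_smul, Pi.add_apply, Pi.smul_apply,
      Finsupp.single_eq_same, Finsupp.single_eq_of_ne hk01, Finsupp.single_eq_of_ne hk01.symm, smul_eq_mul, mul_one,
      mul_zero, add_zero, zero_add, map_zero, Finsupp.coe_zero, Pi.zero_apply] at h0 h1
    exact ⟨h0, h1⟩
  set e := Module.finBasis ℂ ↥(LinearMap.range B) with hedef
  set gC : ↥(LinearMap.range B) →ₗ[ℂ] W := C ∘ₗ (LinearMap.range B).subtype with hgCdef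
  have hgCapply : ∀ x : LinearMap.range B, gC x = C x := fun x => rfl
  have hgCinj : Function.Injective gC := by
    intro x y hxy
    apply Subtype.ext
    have h : C ((x : W) - y) = 0 := by rw [map_sub, sub_eq_zero]; exact hxy
    exact sub_eq_zero.1 (hCinjR _ (Submodule.sub_mem _ x.2 y.2) h)
  obtain ⟨Kc, hKc⟩ := Submodule.exists_isCompl (LinearMap.range gC)
  set proj : W →ₗ[ℂ] ↥(LinearMap.range B) := LinearMap.linearProjOfIsCompl Kc gC hgCinj hKc with hprojdef
  have hproj : ∀ x : LinearMap.range B, proj (C x) = x := fun x =>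
    LinearMap.linearProjOfIsCompl_apply_left Kc gC hgCinj hKc x
  set φ : Fin (Module.finrank ℂ ↥(LinearMap.range B)) → Module.Dual ℂ W := fun j => (e.coord j) ∘ₗ proj with hφdef
  have hφ : ∀ j, ∀ x : LinearMap.range B, φ j (C x) = e.repr x j := fun j x => by
    rw [hφdef]; dsimp only; rw [LinearMap.comp_apply, hproj, Module.Basis.coord_apply]
  -- STEP 5: the involution `Θ' = 2D − Θ` and its Levi instance on `{Θ' = −1} = P₀ ⊕ Q₁`
  set Θ' : Module.End ℂ W := (2 : ℂ) • D - Θ with hΘ'def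
  have hΘ'mem : Θ' ∈ 𝔊 := Submodule.sub_mem _ (Submodule.smul_mem _ _ hD) hΘ
  have hΘ'apply : ∀ w, Θ' w = D w + D w - Θ w := fun w => by
    rw [hΘ'def, LinearMap.sub_apply, LinearMap.smul_apply, two_smul]
  have hΘ'a : ∀ a ∈ LinearMap.range B, Θ' a = a := fun a ha => by
    rw [hΘ'apply, hDfix a ha, (hP a).1 (hrangeP ha)]; abel
  have hΘ'b : ∀ b ∈ P ⊓ LinearMap.ker C, Θ' b = -b := fun b hb => by
    obtain ⟨hbP, hbC⟩ := Submodule.mem_inf.1 hb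
    rw [hΘ'apply, hD2 b hbP (LinearMap.mem_ker.1 hbC), (hP b).1 hbP]; abel
  have hΘ'c : ∀ c ∈ P.map C, Θ' c = -c := fun c hc => by
    obtain ⟨p, hp, rfl⟩ := hc
    rw [hΘ'apply, hD3 p hp, (hQ _).1 (hCmem p)]; abel
  have hΘ'd : ∀ d ∈ Q ⊓ LinearMap.ker B, Θ' d = d := fun d hd => by
    obtain ⟨hdQ, hdB⟩ := Submodule.mem_inf.1 hd
    rw [hΘ'apply, hD4 d hdQ (LinearMap.mem_ker.1 hdB), (hQ d).1 hdQ]; abel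
  have hΘ'Θ' : Θ' * Θ' = 1 := by
    refine LinearMap.ext fun w => ?_
    obtain ⟨a, ha, b, hb, c, hc, d, hd, rfl⟩ := hdec w
    have h1 : Θ' (a + b + c + d) = a - b - c + d := by
      rw [map_add, map_add, map_add, hΘ'a a ha, hΘ'b b hb, hΘ'c c hc, hΘ'd d hd]; abel
    have h2 : Θ' (a - b - c + d) = a + b + c + d := by
      rw [map_add, map_sub, map_sub, hΘ'a a ha, hΘ'b b hb, hΘ'c c hc, hΘ'd d hd]; abel
    rw [Module.End.mul_apply, Module.End.one_apply, h1, h2]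
  have h12 : Θ' * Θ = Θ * Θ' := by
    rw [hΘ'def, sub_mul, mul_sub, smul_mul_assoc, mul_smul_comm, hDΘ]
  have hΘ's : ∀ x y, s (Θ' x) y = s x (Θ' y) := fun x y => by
    rw [hΘ'apply, hΘ'apply, hsubl, hadd, hsubr, haddr, hDs, hΘs]
  set U'' : Submodule ℂ W := LinearMap.ker (Θ' + 1) with hU''def
  have hU'' : ∀ x, x ∈ U'' ↔ Θ' x = -x := fun x => by
    rw [hU''def, LinearMap.mem_ker, LinearMap.add_apply, Module.End.one_apply, add_eq_zero_iff_eq_neg]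
  have hPUle : P ⊓ LinearMap.ker C ≤ U'' := fun b hb => (hU'' b).2 (hΘ'b b hb)
  have hQUle : P.map C ≤ U'' := fun c hc => (hU'' c).2 (hΘ'c c hc)
  have hPUmem : ∀ x ∈ U'', Θ x = x → x ∈ P ⊓ LinearMap.ker C := fun x hxU hΘx => by
    have hxP : x ∈ P := (hP x).2 hΘx
    have h := (hU'' x).1 hxU
    rw [hΘ'apply, hΘx, sub_eq_iff_eq_add, neg_add_cancel, ← two_smul ℂ, smul_eq_zero] at h
    exact Submodule.mem_inf.2 ⟨hxP, LinearMap.mem_ker.2 (hkerD x hxP (h.resolve_left two_ne_zero))⟩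
  have hPUΘ : ∀ x ∈ P ⊓ LinearMap.ker C, Θ x = x := fun x hx => (hP x).1 (Submodule.mem_inf.1 hx).1
  have hQUmem : ∀ x ∈ U'', Θ x = -x → x ∈ P.map C := fun x hxU hΘx => by
    have hxQ : x ∈ Q := (hQ x).2 hΘx
    have h := (hU'' x).1 hxU
    rw [hΘ'apply, hΘx, sub_neg_eq_add, ← sub_eq_zero] at h
    have h' : (2 : ℂ) • (D x + x) = 0 := by rw [two_smul, ← h]; abel
    rw [smul_eq_zero] at h'
    have hDx : D x = -x := eq_neg_of_add_eq_zero_left (h'.resolve_left two_ne_zero)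
    have := (hD6 x hxQ).1
    rw [hDx] at this
    simpa using Submodule.neg_mem _ this
  have hQUΘ : ∀ x ∈ P.map C, Θ x = -x := fun x hx => by
    obtain ⟨p, hp, rfl⟩ := hx; exact (hQ _).1 (hCmem p)
  have hPUQU : ∀ x ∈ P ⊓ LinearMap.ker C, ∀ y ∈ P.map C, s x y = 0 := fun x hx y hy => by
    obtain ⟨p, hp, rfl⟩ := hy; exact hPQ _ (Submodule.mem_inf.1 hx).1 _ (hCmem p)
  have hdefPU : ∀ x ∈ P ⊓ LinearMap.ker C, s x x = 0 → x = 0 := fun x hx h => hdefP x (Submodule.mem_inf.1 hx).1 h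
  have hdefQU : ∀ y ∈ P.map C, s y y = 0 → y = 0 := fun y hy h => by
    obtain ⟨p, hp, rfl⟩ := hy; exact hdefQ _ (hCmem p) h
  -- `dim C(P) = r`, `dim (Q ∩ ker B) = dim Q − r`
  have hmapC : P.map C = LinearMap.range gC := by
    apply le_antisymm
    · rintro _ ⟨p, hp, rfl⟩
      exact ⟨⟨D p, (hD5 p hp).1⟩, by rw [hgCapply, ← hCD p hp]⟩
    · rintro _ ⟨x, rfl⟩
      exact ⟨x, hrangeP x.2, rfl⟩
  have hfinQU : Module.finrank ℂ ↥(P.map C) = Module.finrank ℂ (LinearMap.range B) := by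
    rw [hmapC, LinearMap.finrank_range_of_inj hgCinj]
  have hfinQ₀ : Module.finrank ℂ ↥(Q ⊓ LinearMap.ker B) + Module.finrank ℂ (LinearMap.range B) =
      Module.finrank ℂ Q := by
    have hsup : (Q ⊓ LinearMap.ker B) ⊔ P.map C = Q := by
      apply le_antisymm (sup_le inf_le_left (by rintro _ ⟨p, hp, rfl⟩; exact hCmem p))
      intro q hq
      obtain ⟨hDq, hBq⟩ := hD6 q hq
      have h : q = (q + D q) + (-(D q)) := by abel
      rw [h]
      refine Submodule.add_mem _ (Submodule.mem_sup_left (Submodule.mem_inf.2 ⟨Submodule.add_mem _ hq ?_,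
        LinearMap.mem_ker.2 hBq⟩)) (Submodule.mem_sup_right (Submodule.neg_mem _ hDq))
      obtain ⟨p, hp, hpq⟩ := hDq
      rw [← hpq]; exact hCmem p
    have hinf : (Q ⊓ LinearMap.ker B) ⊓ P.map C = ⊥ := by
      rw [eq_bot_iff]
      rintro x ⟨⟨-, hxB⟩, ⟨p, hp, rfl⟩⟩
      rw [Submodule.mem_bot]
      exact hpos1 p hp (LinearMap.mem_ker.1 hxB)
    have h := Submodule.finrank_sup_add_finrank_inf_eq (Q ⊓ LinearMap.ker B) (P.map C)
    rw [hsup, hinf, finrank_bot, add_zero, hfinQU] at h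
    exact h.symm
  -- the Levi instance: every endomorphism of `U''` is a restriction
  have hLevi := UnitaryThreeCoprime.levi_instance hbr hirr hΘΘ hP hQ hadd hsymm hPQ hdefP hdefQ hadj hΘ'mem hΘ'Θ'
    hΘ's hΘ hΘΘ h12 hU'' hPUle hQUle hPUmem hPUΘ hQUmem hQUΘ hPUQU hdefPU hdefQU
    (fun 𝔩 ι P' Q' hbr𝔩 hirr𝔩 hι hιι hP' hQ' hfinP' hfinQ' hP'Q' hdefP' hdefQ' hadj𝔩 =>
      hcore U'' 𝔩 ι P' Q' hbr𝔩 hirr𝔩 hι hιι hP' hQ' (by rw [hfinP']; exact hfinP₀) (by rw [hfinQ', hfinQU]) hP'Q' hdefP'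
        hdefQ' hadj𝔩)
  -- STEP 6: raising operators `B_{j,η}` with `B_{j,η}(C x) = eⱼ^*(x) η` (`η ∈ P₀`)
  have hZex : ∀ (j : Fin (Module.finrank ℂ ↥(LinearMap.range B))) (η : ↥(P ⊓ LinearMap.ker C)),
      ∃ Z ∈ 𝔊, Z * Θ' = Θ' * Z ∧
        ∀ x : U'', ((((φ j) ∘ₗ U''.subtype).smulRight (⟨(η : W), hPUle η.2⟩ : U'') x : U'') : W) = Z x :=
    fun j η => hLevi _
  choose Z hZmem hZΘ' hZval using hZex
  have hZval' : ∀ j η, ∀ x ∈ U'', Z j η x = (φ j x) • (η : W) := fun j η x hx => by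
    have h := hZval j η ⟨x, hx⟩
    rw [LinearMap.smulRight_apply, LinearMap.comp_apply, Submodule.subtype_apply, Submodule.coe_smul] at h
    exact h.symm
  obtain ⟨Bj, hBjdef⟩ : ∃ Bj : Fin (Module.finrank ℂ ↥(LinearMap.range B)) → ↥(P ⊓ LinearMap.ker C) → Module.End ℂ W,
      ∀ j η, Bj j η = (4 : ℂ)⁻¹ • (Z j η + Θ * Z j η - Z j η * Θ - Θ * Z j η * Θ) := ⟨_, fun j η => rfl⟩
  have hBjrel : ∀ j η, Bj j η ∈ 𝔊 ∧ Θ * Bj j η = Bj j η ∧ Bj j η * Θ = -(Bj j η) := fun j η => by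
    rw [hBjdef j η]; exact UnitaryThetaCore.raise_relations hbr hΘ hΘΘ (hZmem j η)
  have hBjval : ∀ j η, ∀ v ∈ P.map C, Bj j η v = (φ j v) • (η : W) := fun j η v hv => by
    have hvQ : Θ v = -v := hQUΘ v hv
    have hZv : Z j η v = (φ j v) • (η : W) := hZval' j η v (hQUle hv)
    have hΘZv : Θ (Z j η v) = Z j η v := by rw [hZv, map_smul, (hηfacts _ η.2).2.2]
    rw [hBjdef j η, LinearMap.smul_apply, LinearMap.sub_apply, LinearMap.sub_apply, LinearMap.add_apply,
      Module.End.mul_apply, Module.End.mul_apply, Module.End.mul_apply, Module.End.mul_apply, hvQ, map_neg, map_neg,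
      hΘZv, ← hZv]
    module
  have hBjC : ∀ j η, ∀ x : LinearMap.range B, Bj j η (C x) = (e.repr x j) • (η : W) := fun j η x => by
    rw [hBjval j η _ ⟨x, hrangeP x.2, rfl⟩, hφ]
  have hBjQ₀ : ∀ j η, ∀ q ∈ Q, B q = 0 → Bj j η q ∈ LinearMap.range B := fun j η q hq hBq =>
    hstar' (Bj j η) (hBjrel j η).1 (hBjrel j η).2.1 (hBjrel j η).2.2 q hq hBq
  -- coordinates vanish ⟹ vector vanishes
  have hrepr0 : ∀ x : LinearMap.range B, (∀ j, e.repr x j = 0) → (x : W) = 0 := fun x h => by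
    have hx : x = 0 := e.forall_coord_eq_zero_iff.1 fun j => by rw [Module.Basis.coord_apply]; exact h j
    rw [hx, Submodule.coe_zero]
  -- (♣) in `P₁ ∩ P₀`-form
  have hP01 : ∀ x ∈ LinearMap.range B, ∀ c₀ c₁ : ℂ,
      x = c₀ • ((fP k₀ : ↥(P ⊓ LinearMap.ker C)) : W) + c₁ • ((fP k₁ : ↥(P ⊓ LinearMap.ker C)) : W) →
      c₀ = 0 ∧ c₁ = 0 := by
    intro x hx c₀ c₁ hxc
    apply hindep
    rw [← hxc]
    have h1 := hDfix x hx
    rw [hxc, map_add, map_smul, map_smul, (hηfacts _ (fP k₀).2).2.1, (hηfacts _ (fP k₁).2).2.1, smul_zero,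
      smul_zero, add_zero] at h1
    rw [hxc]; exact h1.symm
  -- STEP 7: `B_{j,η₀}` kills `Q₀` (pair it with `B_{i,η₁}` in (♣))
  have hkill₀ : ∀ j, ∀ q ∈ Q, B q = 0 → Bj j (fP k₀) q = 0 := by
    intro j q hq hBq
    set v : LinearMap.range B := ⟨Bj j (fP k₀) q, hBjQ₀ j (fP k₀) q hq hBq⟩ with hvdef
    have hcoord : ∀ i, e.repr v i = 0 := fun i => by
      set w : LinearMap.range B := ⟨Bj i (fP k₁) q, hBjQ₀ i (fP k₁) q hq hBq⟩ with hwdef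
      have h := hclub (Bj j (fP k₀)) (hBjrel j _).1 (hBjrel j _).2.1 (hBjrel j _).2.2 (Bj i (fP k₁)) (hBjrel i _).1
        (hBjrel i _).2.1 (hBjrel i _).2.2 q hq hBq
      have h1 : Bj j (fP k₀) (C (Bj i (fP k₁) q)) = (e.repr w j) • ((fP k₀ : ↥(P ⊓ LinearMap.ker C)) : W) :=
        hBjC j (fP k₀) w
      have h2 : Bj i (fP k₁) (C (Bj j (fP k₀) q)) = (e.repr v i) • ((fP k₁ : ↥(P ⊓ LinearMap.ker C)) : W) :=
        hBjC i (fP k₁) v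
      rw [h1, h2] at h
      have hmem : (e.repr w j) • ((fP k₀ : ↥(P ⊓ LinearMap.ker C)) : W) +
          (e.repr v i) • ((fP k₁ : ↥(P ⊓ LinearMap.ker C)) : W) ∈ LinearMap.range B := by
        rw [← h]
        exact (hD5 _ (Submodule.add_mem _ (Submodule.smul_mem _ _ (Submodule.mem_inf.1 (fP k₀).2).1)
          (Submodule.smul_mem _ _ (Submodule.mem_inf.1 (fP k₁).2).1))).1
      exact (hP01 _ hmem _ _ rfl).2
    exact hrepr0 v hcoord
  -- STEP 8: hence every raising operator kills `Q₀`
  have hkill : ∀ q ∈ Q, B q = 0 → ∀ B' ∈ 𝔊, Θ * B' = B' → B' * Θ = -B' → B' q = 0 := by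
    intro q hq hBq B' hB' hΘB' hB'Θ
    have hyr : B' q ∈ LinearMap.range B := hstar' B' hB' hΘB' hB'Θ q hq hBq
    set y : LinearMap.range B := ⟨B' q, hyr⟩ with hydef
    have hcoord : ∀ i, e.repr y i = 0 := fun i => by
      have h := hclub B' hB' hΘB' hB'Θ (Bj i (fP k₀)) (hBjrel i _).1 (hBjrel i _).2.1 (hBjrel i _).2.2 q hq hBq
      have h1 : Bj i (fP k₀) (C (B' q)) = (e.repr y i) • ((fP k₀ : ↥(P ⊓ LinearMap.ker C)) : W) := hBjC i (fP k₀) y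
      rw [hkill₀ i q hq hBq, map_zero, map_zero, zero_add, h1] at h
      have hmem : (e.repr y i) • ((fP k₀ : ↥(P ⊓ LinearMap.ker C)) : W) +
          (0 : ℂ) • ((fP k₁ : ↥(P ⊓ LinearMap.ker C)) : W) ∈ LinearMap.range B := by
        rw [zero_smul, add_zero, ← h]
        exact (hD5 _ (Submodule.smul_mem _ _ (Submodule.mem_inf.1 (fP k₀).2).1)).1
      exact (hP01 _ hmem _ _ rfl).1
    exact hrepr0 y hcoord
  -- STEP 9: `Q₀ ≠ 0` — contradiction with the covering lemma
  obtain ⟨⟨q, hqQ₀⟩, hq0⟩ := Module.finrank_pos_iff_exists_ne_zero.1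
    (show 0 < Module.finrank ℂ ↥(Q ⊓ LinearMap.ker B) by omega)
  obtain ⟨hqQ, hqB⟩ := Submodule.mem_inf.1 hqQ₀
  have hq0' : q ≠ 0 := fun h => hq0 (Subtype.ext h)
  exact hq0' (UnitaryThetaCore.eq_zero_of_forall_raise_apply_eq_zero hbr hirr hΘ hΘΘ hP0 ((hQ q).1 hqQ)
    fun B' hB' hΘB' hB'Θ => hkill q hqQ (LinearMap.mem_ker.1 hqB) B' hB' hΘB' hB'Θ)

end HodgeStructure

end Literature.AlgebraicGeometry.Motives

end
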